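import Summits.QuantumAdvantage.QuantumAdvantage.Theorems.CubicForrelationNearExactIsExactFourteenSecondLevelSeven

/-!
# Crux `CubicForrelation.NearExactIsExact` (stmt-QuantumAdvantage-14043) — n = 14 at the SECOND boundary `15/16`: a BENT cubic never has
  a cubic partner at exactly `Φ = 15/16`; hence `W_g ∈ 128ℤ ∧ Φ ≥ 15/16 ⇒ Φ = 1`

Certificate seat `b2b-cforr-cert` (gen 9).  HONEST FRAMING: a theorem about cubic Boolean functions on 14 bits (finite slice `n = 14` of
the crux; the bent branch of the case analysis of `Φ ≥ 15/16 ⇒ Φ = 1`) — NOT summit progress.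

One-sidedly a bent cubic `g` on 14 bits with dual `d` (degree `≤ 5`, Hou) has `Φ(f,g) = 1 − 2·dist(f,d)/2¹⁴ ∈ {1} ∪ [≤ 15/16]` for cubic `f`
(`tw_bent_end`), and `15/16` means `dist(f,d) = 2⁹`: the word `f ⊕ d` (degree `≤ 5`) is a minimum-weight word of `RM(5,14)`, i.e. `f`
and `d` differ exactly on a 9-flat `A = x₀ ⊕ V_A` (`mw_flat_of_minweight`).  Two-sidedly this is impossible (`fo_bent_false`): in the
`f`-domain the residual `u − 4s = 4((−1)^d − (−1)^f) = 8(−1)^d·1_A` (`W_g = 32u = 128(−1)^d`) has general 7-flat sums `≡ 0 (mod 32)`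
(`fs_flat_sum_dvd`, `sl_sum_sZ_flat`); five directions transversal to `V_A` (doubling `V_A` five times, `fo_double_closed`) localise a
7-flat to a 2-flat inside `A` (`fr_sum_peel`, `fo_mem_flatPt`), so every 2-flat sign sum of `d` inside `A` is `≡ 0 (mod 4)`: `d` is AFFINE
along `A` (`fl_signs_of_four_dvd`).  Then `D(y) := Σ_{x∈A} (−1)^{d(x)+x·y}` is a multiplicative character sum over `V_A` (`fo_sum_mult_char`),
`|D(y)| ∈ {0, 2⁹}`, so by Parseval `Σ_y |D(y)| = Σ_y D(y)²/2⁹ = 2¹⁴`; but bent duality `W_d = 128(−1)^g` (`tz_inversion`) and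
`W_f = W_d − 2D` turn `2²¹Φ(g,f) = Σ_y (−1)^{g(y)} W_f(y)` into `Σ_y (−1)^{g(y)} D(y) = 2¹⁶ > 2¹⁴`.  With `fo_levelSeven`:
`fo_levelSeven_exact` — for cubic `f, g` on 14 bits, `W_g ∈ 128ℤ ∧ Φ ≥ 15/16 ⇒ Φ = 1`.

References: O. S. Rothaus (1976); X.-D. Hou (1998); C. Carlet (2021) §6.1; J. Ax (1964) / R. J. McEliece (1972); MacWilliams–Sloane (1977)
Ch. 13 §4.  Everything below is proved from Mathlib and the tree; axioms are the standard three.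
-/

set_option linter.dupNamespace false -- D-0017: single-problem summit ⇒ `QuantumAdvantage.QuantumAdvantage` by design

noncomputable section

namespace Summit.QuantumAdvantage.QuantumAdvantage.Theorems.CubicForrelation.NearExactIsExact

open Finset
open Literature.Computability.QuantumComplexity
open Literature.Computability.QuantumComplexity.BuzetChailloux (bxor zeroVec bxor_bxor_cancel_left bxor_zeroVec zeroVec_bxor bxor_comm
  bxor_self)
open Literature.Computability.QuantumComplexity.DerivativeWalsh (W twist_bxor_left)

variable {n : ℕ}

/-! ### Small tools: flat points in a coset, doubling a closed set, multiplicative character sums -/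

/-- Flat points with base in `S` and all `k` directions in `V₀` stay in `S` (`S` stable under `⊕ V₀`), any `k`. [folklore] -/
theorem fo_mem_flatPt {k : ℕ} (V₀ : Finset (Fin n → Bool)) (h0 : zeroVec ∈ V₀) (P : (Fin n → Bool) → Prop)
    (hPV : ∀ x, P x → ∀ a ∈ V₀, P (bxor x a)) {x : Fin n → Bool} (hx : P x) (a : Fin k → Fin n → Bool)
    (ha : ∀ i, a i ∈ V₀) (ε : Fin k → Bool) :
    P (fun j => x j ^^ decide (Odd #(univ.filter fun i => ε i && a i j))) := by
  induction k with
  | zero => rw [tep_flatPt_nil]; exact hx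
  | succ k ih =>
    have e1 : (fun j => x j ^^ decide (Odd #(univ.filter fun i => ε i && a i j))) =
        (fun j => x j ^^ decide (Odd #(univ.filter fun i : Fin (k + 1) =>
          (Fin.cons (ε 0) (Fin.tail ε) : Fin (k + 1) → Bool) i &&
            (Fin.cons (a 0) (Fin.tail a) : Fin (k + 1) → Fin n → Bool) i j))) := by
      rw [Fin.cons_self_tail, Fin.cons_self_tail]
    rw [e1, erm_flatPt_cons]
    have h2 := ih (Fin.tail a) (fun i => ha _) (Fin.tail ε)
    have h3 := hPV _ h2 _ (fr_smul_mem V₀ h0 (ha 0) (ε 0))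
    exact h3

/-- **Doubling a closed set.** For `⊕`-closed `U ∋ 0` and any `t`, `U' = U ∪ (t ⊕ U)` is `⊕`-closed, contains `0`, `U` and `t`, and
`#U' ≤ 2·#U`. [folklore] -/
theorem fo_double_closed (U : Finset (Fin n → Bool)) (h0 : zeroVec ∈ U) (hadd : ∀ a ∈ U, ∀ b ∈ U, bxor a b ∈ U)
    (t : Fin n → Bool) :
    zeroVec ∈ U ∪ U.image (bxor t) ∧
    (∀ a ∈ U ∪ U.image (bxor t), ∀ b ∈ U ∪ U.image (bxor t), bxor a b ∈ U ∪ U.image (bxor t)) ∧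
    U ⊆ U ∪ U.image (bxor t) ∧ t ∈ U ∪ U.image (bxor t) ∧ #(U ∪ U.image (bxor t)) ≤ 2 * #U := by
  classical
  refine ⟨mem_union_left _ h0, ?_, subset_union_left, mem_union_right _ (mem_image.2 ⟨zeroVec, h0, bxor_zeroVec t⟩), ?_⟩
  · intro a ha b hb
    rcases mem_union.1 ha with ha | ha <;> rcases mem_union.1 hb with hb | hb
    · exact mem_union_left _ (hadd a ha b hb)
    · obtain ⟨b', hb', rfl⟩ := mem_image.1 hb
      refine mem_union_right _ (mem_image.2 ⟨bxor a b', hadd a ha b' hb', ?_⟩)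
      rw [← iw_bxor_assoc, bxor_comm t a, iw_bxor_assoc]
    · obtain ⟨a', ha', rfl⟩ := mem_image.1 ha
      refine mem_union_right _ (mem_image.2 ⟨bxor a' b, hadd a' ha' b hb, ?_⟩)
      rw [iw_bxor_assoc]
    · obtain ⟨a', ha', rfl⟩ := mem_image.1 ha
      obtain ⟨b', hb', rfl⟩ := mem_image.1 hb
      refine mem_union_left _ ?_
      have e : bxor (bxor t a') (bxor t b') = bxor a' b' := by
        rw [iw_bxor_assoc, ← iw_bxor_assoc a' t b', bxor_comm a' t, iw_bxor_assoc, bxor_bxor_cancel_left]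
      rw [e]; exact hadd a' ha' b' hb'
  · calc #(U ∪ U.image (bxor t)) ≤ #U + #(U.image (bxor t)) := card_union_le _ _
      _ ≤ #U + #U := Nat.add_le_add_left card_image_le _
      _ = 2 * #U := by ring

/-- **A multiplicative `±1` character of a `⊕`-closed set sums to `0` or to the size of the set.** [folklore] -/
theorem fo_sum_mult_char (V₀ : Finset (Fin n → Bool)) (hadd : ∀ a ∈ V₀, ∀ b ∈ V₀, bxor a b ∈ V₀)
    (ρ : (Fin n → Bool) → ℝ) (h1 : ∀ v ∈ V₀, ρ v = 1 ∨ ρ v = -1) (hmul : ∀ v ∈ V₀, ∀ w ∈ V₀, ρ (bxor v w) = ρ v * ρ w) :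
    ∑ v ∈ V₀, ρ v = 0 ∨ ∑ v ∈ V₀, ρ v = #V₀ := by
  classical
  by_cases hall : ∀ v ∈ V₀, ρ v = 1
  · right; rw [sum_congr rfl hall, sum_const, nsmul_eq_mul, mul_one]
  · left
    push Not at hall
    obtain ⟨v₀, hv₀, hne⟩ := hall
    have hneg : ρ v₀ = -1 := (h1 v₀ hv₀).resolve_left hne
    have hre : ∑ v ∈ V₀, ρ v = ∑ v ∈ V₀, ρ (bxor v₀ v) :=
      (sum_nbij' (fun v => bxor v₀ v) (fun v => bxor v₀ v) (fun v hv => hadd v₀ hv₀ v hv) (fun v hv => hadd v₀ hv₀ v hv)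
        (fun v _ => bxor_bxor_cancel_left v₀ v) (fun v _ => bxor_bxor_cancel_left v₀ v) (fun v _ => rfl)).symm
    rw [sum_congr rfl fun v hv => hmul v₀ hv₀ v hv, ← mul_sum, hneg] at hre
    linarith


/-! ### The bent branch at `Φ = 15/16` -/

/-- **A bent cubic on 14 bits has no cubic partner at `Φ = 15/16`.**  For cubic `f, g : 𝔽₂¹⁴ → 𝔽₂` with `g` bent (`W_g² ≡ 2¹⁴`) and
`Φ(f,g) = 15/16`: contradiction (the header describes the proof).  Finite-slice statement; NOT summit progress. [this work] -/
theorem fo_bent_false (f g : (Fin (7 + 7) → Bool) → Bool) (hf : IsDegLeFun 3 f) (hg : IsDegLeFun 3 g)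
    (hbent : ∀ x, W (fun y => signOf (g y)) x ^ 2 = (2 : ℝ) ^ (7 + 7)) (hΦ : forrelation f g = 15 / 16) : False := by
  classical
  -- the dual and its degree
  obtain ⟨d, hd⟩ := bb_exists_dual hbent
  have hdeg : IsDegLeFun (4 + 1) d := stub_houCubic stub_axParity 7 g d hg hd
  -- distance `512`
  have hsum := vg_two_pow_mul_forrelation f g
  rw [hΦ, sum_congr rfl fun x _ => by rw [hd x]] at hsum
  have hsd : ∑ x, signOf (f x) * signOf (d x) = 15360 := by
    have e : ∑ x, signOf (f x) * ((2 : ℝ) ^ 7 * signOf (d x)) = 2 ^ 7 * ∑ x, signOf (f x) * signOf (d x) := by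
      rw [mul_sum]; exact sum_congr rfl fun x _ => by ring
    have c : (2 : ℝ) ^ (3 * 7) * (15 / 16) = 2 ^ 7 * 15360 := by norm_num
    rw [e, c] at hsum
    exact (mul_left_cancel₀ (by norm_num) hsum).symm
  rw [bb_sum_signOf_mul_signOf, ← bb_filter_bxor_eq] at hsd
  have hcard : #(univ.filter fun x : Fin (7 + 7) → Bool => (f x ^^ d x) = true) = 512 := by
    have c : (2 : ℝ) ^ (7 + 7) = 16384 := by norm_num
    rw [c] at hsd
    have h : (#(univ.filter fun x : Fin (7 + 7) → Bool => (f x ^^ d x) = true) : ℝ) = 512 := by linarith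
    exact_mod_cast h
  -- the word `f ⊕ d` is a minimum-weight word of `RM(5,14)`: a 9-flat `A`
  have he : IsDegLeFun (4 + 1) (fun x => f x ^^ d x) := bb_isDegLeFun_bxor (hf.mono (by norm_num)) hdeg
  obtain ⟨h0, hadd, hcardV, hcoset⟩ := mw_flat_of_minweight 4 (fun x => f x ^^ d x) he (by rw [hcard]; norm_num)
  set V := univ.filter (fun a : Fin (7 + 7) → Bool => ∀ x, (f (bxor x a) ^^ d (bxor x a)) = (f x ^^ d x)) with hVdef
  rw [hcard] at hcardV
  have hApos : 0 < #(univ.filter fun x : Fin (7 + 7) → Bool => (f x ^^ d x) = true) := by rw [hcard]; norm_num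
  obtain ⟨x₀, hx₀⟩ := card_pos.1 hApos
  have hx₀' : (f x₀ ^^ d x₀) = true := (mem_filter.1 hx₀).2
  set A := univ.filter (fun x : Fin (7 + 7) → Bool => (f x ^^ d x) = true) with hAdef
  have hS : A = V.image (bxor x₀) := hcoset x₀ hx₀'
  have hmemA : ∀ x, x ∈ A ↔ (f x ^^ d x) = true := fun x => by simp [hAdef]
  have hAV : ∀ x, x ∈ A → ∀ a ∈ V, bxor x a ∈ A := fun x hx a ha => fl1_coset_vadd hadd hS hx ha
  -- the `g`-side residual in the `f`-domain: `u − 4s = 8(−1)^d·1_A`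
  set u : (Fin (7 + 7) → Bool) → ℤ := fun x => 4 * sZ (d x) with hudef
  have hu : ∀ x, W (fun y => signOf (g y)) x = (2 : ℝ) ^ 5 * (u x : ℝ) := by
    intro x; rw [hd x]; simp only [u]; push_cast; rw [tp_sZ_cast]; ring
  set τ : (Fin (7 + 7) → Bool) → ℤ := fun x => u x - 4 * sZ (f x) with hτdef
  have hτA : ∀ x, x ∈ A → τ x = 8 * sZ (d x) := by
    intro x hx
    have h := (hmemA x).1 hx
    simp only [τ, u]
    have : f x = !d x := by revert h; cases f x <;> cases d x <;> decide
    rw [this]; cases d x <;> simp [sZ]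
  have hτ0 : ∀ x, x ∉ A → τ x = 0 := by
    intro x hx
    have h : ¬ (f x ^^ d x) = true := fun h' => hx ((hmemA x).2 h')
    simp only [τ, u]
    have : f x = d x := by revert h; cases f x <;> cases d x <;> decide
    rw [this]; ring
  -- general 7-flat sums of `τ` are `≡ 0 (mod 32)`
  have h32 : ∀ (b : Fin (7 + 7) → Bool) (a : Fin 7 → Fin (7 + 7) → Bool),
      (32 : ℤ) ∣ ∑ ε : Fin 7 → Bool, τ (fun j => b j ^^ decide (Odd #(univ.filter fun i => ε i && a i j))) := by
    intro b a
    have h1 := fs_flat_sum_dvd (e := 5) g u hg hu b a (by norm_num)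
    obtain ⟨zf, hzf⟩ := sl_sum_sZ_flat f hf b a
    have h2 : ∑ ε : Fin 7 → Bool, τ (fun j => b j ^^ decide (Odd #(univ.filter fun i => ε i && a i j))) =
        ∑ ε : Fin 7 → Bool, u (fun j => b j ^^ decide (Odd #(univ.filter fun i => ε i && a i j))) -
        4 * ∑ ε : Fin 7 → Bool, sZ (f (fun j => b j ^^ decide (Odd #(univ.filter fun i => ε i && a i j)))) := by
      simp only [τ]; rw [sum_sub_distrib, mul_sum]
    rw [h2, hzf]
    norm_num at h1 ⊢
    exact dvd_sub h1 (Dvd.intro _ (by ring))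
  -- peeling one transversal direction
  have hpeel : ∀ (U : Finset (Fin (7 + 7) → Bool)), zeroVec ∈ U → (∀ a ∈ U, ∀ b ∈ U, bxor a b ∈ U) → V ⊆ U →
      ∀ t, t ∉ U → ∀ q, q ∈ A → ∀ {k : ℕ} (a : Fin k → Fin (7 + 7) → Bool), (∀ i, a i ∈ U) →
      ∑ ε : Fin (k + 1) → Bool, τ (fun j => q j ^^ decide (Odd #(univ.filter fun i =>
          ε i && (Matrix.vecCons t a : Fin (k + 1) → Fin (7 + 7) → Bool) i j))) =
        ∑ ε : Fin k → Bool, τ (fun j => q j ^^ decide (Odd #(univ.filter fun i => ε i && a i j))) := by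
    intro U hU0 hUadd hVU t ht q hq k a ha
    rw [fr_sum_peel τ q t a]
    have hz : ∑ ε : Fin k → Bool, τ (bxor (fun j => q j ^^ decide (Odd #(univ.filter fun i => ε i && a i j))) t) = 0 := by
      refine sum_eq_zero fun ε _ => hτ0 _ fun hmem => ?_
      set S := U.image (bxor q) with hSU
      have hpt : (fun j => q j ^^ decide (Odd #(univ.filter fun i => ε i && a i j))) ∈ S :=
        fo_mem_flatPt U hU0 (· ∈ S) (fun x hx b hb => fl1_coset_vadd hUadd hSU hx hb)
          (show q ∈ S from mem_image.2 ⟨zeroVec, hU0, bxor_zeroVec q⟩) a ha ε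
      have hout := fl1_coset_out hU0 hUadd hSU hpt ht
      apply hout
      -- `A ⊆ S`
      rw [hS] at hmem hq
      obtain ⟨v, hv, hvx⟩ := mem_image.1 hmem
      obtain ⟨v₀, hv₀, hv₀q⟩ := mem_image.1 hq
      refine mem_image.2 ⟨bxor v₀ v, hVU (hadd v₀ hv₀ v hv), ?_⟩
      rw [← hvx, ← hv₀q, iw_bxor_assoc, bxor_bxor_cancel_left]
    rw [hz, add_zero]
  -- five transversal directions by doubling
  have hNcard : #(univ : Finset (Fin (7 + 7) → Bool)) = 16384 := by
    rw [card_univ, Fintype.card_fun, Fintype.card_bool, Fintype.card_fin]; norm_num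
  have hpick : ∀ (U : Finset (Fin (7 + 7) → Bool)), #U < 16384 → ∃ t, t ∉ U := fun U hU => by
    obtain ⟨t, -, ht⟩ := exists_mem_notMem_of_card_lt_card (hNcard ▸ hU); exact ⟨t, ht⟩
  obtain ⟨t₅, ht₅⟩ := hpick V (by rw [hcardV]; norm_num)
  obtain ⟨h40, h4add, h4sub, h4t, h4card⟩ := fo_double_closed V h0 hadd t₅
  set U₄ := V ∪ V.image (bxor t₅) with hU₄
  obtain ⟨t₄, ht₄⟩ := hpick U₄ (by rw [hcardV] at h4card; omega)
  obtain ⟨h30, h3add, h3sub, h3t, h3card⟩ := fo_double_closed U₄ h40 h4add t₄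
  set U₃ := U₄ ∪ U₄.image (bxor t₄) with hU₃
  obtain ⟨t₃, ht₃⟩ := hpick U₃ (by rw [hcardV] at h4card; omega)
  obtain ⟨h20, h2add, h2sub, h2t, h2card⟩ := fo_double_closed U₃ h30 h3add t₃
  set U₂ := U₃ ∪ U₃.image (bxor t₃) with hU₂
  obtain ⟨t₂, ht₂⟩ := hpick U₂ (by rw [hcardV] at h4card; omega)
  obtain ⟨h10, h1add, h1sub, h1t, h1card⟩ := fo_double_closed U₂ h20 h2add t₂
  set U₁ := U₂ ∪ U₂.image (bxor t₂) with hU₁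
  obtain ⟨t₁, ht₁⟩ := hpick U₁ (by rw [hcardV] at h4card; omega)
  -- (H2): 2-flat sign sums of `d` inside `A` are `≡ 0 (mod 4)`
  have H2 : ∀ q, q ∈ A → ∀ a b : Fin (7 + 7) → Bool, a ∈ V → b ∈ V →
      sZ (d (bxor (bxor q b) a)) * sZ (d q) = sZ (d (bxor q b)) * sZ (d (bxor q a)) := by
    intro q hq a b ha hb
    have h7 := h32 q ![t₁, t₂, t₃, t₄, t₅, a, b]
    have m5 : t₅ ∈ U₁ := h1sub (h2sub (h3sub h4t))
    have m4 : t₄ ∈ U₁ := h1sub (h2sub h3t)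
    have m3 : t₃ ∈ U₁ := h1sub h2t
    have ma : a ∈ U₁ := h1sub (h2sub (h3sub (h4sub ha)))
    have mb : b ∈ U₁ := h1sub (h2sub (h3sub (h4sub hb)))
    rw [hpeel U₁ h10 h1add (h4sub.trans (h3sub.trans (h2sub.trans h1sub))) t₁ ht₁ q hq ![t₂, t₃, t₄, t₅, a, b]
      (fun i => by fin_cases i <;> first | exact h1t | exact m3 | exact m4 | exact m5 | exact ma | exact mb)] at h7
    have m5' : t₅ ∈ U₂ := h2sub (h3sub h4t)
    have m4' : t₄ ∈ U₂ := h2sub h3t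
    have ma' : a ∈ U₂ := h2sub (h3sub (h4sub ha))
    have mb' : b ∈ U₂ := h2sub (h3sub (h4sub hb))
    rw [hpeel U₂ h20 h2add (h4sub.trans (h3sub.trans h2sub)) t₂ ht₂ q hq ![t₃, t₄, t₅, a, b]
      (fun i => by fin_cases i <;> first | exact h2t | exact m4' | exact m5' | exact ma' | exact mb')] at h7
    have m5'' : t₅ ∈ U₃ := h3sub h4t
    have ma'' : a ∈ U₃ := h3sub (h4sub ha)
    have mb'' : b ∈ U₃ := h3sub (h4sub hb)
    rw [hpeel U₃ h30 h3add (h4sub.trans h3sub) t₃ ht₃ q hq ![t₄, t₅, a, b]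
      (fun i => by fin_cases i <;> first | exact h3t | exact m5'' | exact ma'' | exact mb'')] at h7
    have ma3 : a ∈ U₄ := h4sub ha
    have mb3 : b ∈ U₄ := h4sub hb
    rw [hpeel U₄ h40 h4add h4sub t₄ ht₄ q hq ![t₅, a, b]
      (fun i => by fin_cases i <;> first | exact h4t | exact ma3 | exact mb3)] at h7
    rw [hpeel V h0 hadd subset_rfl t₅ ht₅ q hq ![a, b] (fun i => by fin_cases i <;> assumption)] at h7
    have p1 := fr_sum_peel τ q b ![]
    have p2 := fr_sum_peel (fun z => τ (bxor z a)) q b ![]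
    beta_reduce at p2
    rw [fr_sum_peel τ q a ![b], p1, p2] at h7
    simp only [univ_unique, sum_singleton, tep_flatPt_nil] at h7
    have hqb : bxor q b ∈ A := hAV q hq b hb
    have hqa : bxor q a ∈ A := hAV q hq a ha
    have hqba : bxor (bxor q b) a ∈ A := hAV _ hqb a ha
    rw [hτA q hq, hτA _ hqb, hτA _ hqa, hτA _ hqba] at h7
    have h4 : (4 : ℤ) ∣ sZ (d q) + sZ (d (bxor q b)) + sZ (d (bxor q a)) + sZ (d (bxor (bxor q b) a)) := by
      have e : (8 * sZ (d q) + 8 * sZ (d (bxor q b)) + (8 * sZ (d (bxor q a)) + 8 * sZ (d (bxor (bxor q b) a))) : ℤ) =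
          8 * (sZ (d q) + sZ (d (bxor q b)) + sZ (d (bxor q a)) + sZ (d (bxor (bxor q b) a))) := by ring
      rw [e, show (32 : ℤ) = 8 * 4 by norm_num] at h7
      exact (mul_dvd_mul_iff_left (by norm_num : (8 : ℤ) ≠ 0)).1 h7
    exact fl_signs_of_four_dvd (tp_sZ_cases _) (tp_sZ_cases _) (tp_sZ_cases _) (tp_sZ_cases _) h4
  -- the multiplicative character on `V` and the values of `D`
  set D : (Fin (7 + 7) → Bool) → ℝ := W (fun x => if x ∈ A then signOf (d x) else 0) with hDdef
  have hDval : ∀ y, D y = 0 ∨ D y = 512 * (signOf (d x₀) * twist x₀ y) ∨ D y = -(512 * (signOf (d x₀) * twist x₀ y)) := by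
    intro y
    set ρ : (Fin (7 + 7) → Bool) → ℝ := fun v => signOf (d (bxor x₀ v)) * signOf (d x₀) * twist v y with hρ
    have hρ1 : ∀ v ∈ V, ρ v = 1 ∨ ρ v = -1 := by
      intro v _
      simp only [ρ]
      rcases Simon.twist_eq_one_or v y with h | h <;> rw [h] <;> unfold signOf <;> split_ifs <;> norm_num
    have hρmul : ∀ v ∈ V, ∀ w ∈ V, ρ (bxor v w) = ρ v * ρ w := by
      intro v hv w hw
      simp only [ρ]
      have hx₀A : x₀ ∈ A := hx₀
      have key := H2 x₀ hx₀A w v hw hv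
      have key' : signOf (d (bxor (bxor x₀ v) w)) * signOf (d x₀) = signOf (d (bxor x₀ v)) * signOf (d (bxor x₀ w)) := by
        have := congrArg (fun z : ℤ => (z : ℝ)) key
        push_cast at this
        rw [tp_sZ_cast, tp_sZ_cast, tp_sZ_cast, tp_sZ_cast] at this
        exact this
      rw [← iw_bxor_assoc, twist_bxor_left]
      have hs : signOf (d x₀) * signOf (d x₀) = 1 := by unfold signOf; split_ifs <;> norm_num
      calc signOf (d (bxor (bxor x₀ v) w)) * signOf (d x₀) * (twist v y * twist w y)
          = (signOf (d (bxor x₀ v)) * signOf (d (bxor x₀ w))) * (twist v y * twist w y) := by rw [key']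
        _ = (signOf (d (bxor x₀ v)) * signOf (d (bxor x₀ w))) * (signOf (d x₀) * signOf (d x₀)) * (twist v y * twist w y) := by
            rw [hs, mul_one]
        _ = signOf (d (bxor x₀ v)) * signOf (d x₀) * twist v y * (signOf (d (bxor x₀ w)) * signOf (d x₀) * twist w y) := by ring
    have hsumρ := fo_sum_mult_char V hadd ρ hρ1 hρmul
    have hDρ : D y = signOf (d x₀) * twist x₀ y * ∑ v ∈ V, ρ v := by
      simp only [D]
      unfold W
      rw [← sum_filter_add_sum_filter_not univ (fun x => x ∈ A)]
      have hz : ∑ x ∈ univ.filter (fun x => ¬ x ∈ A), (if x ∈ A then signOf (d x) else 0) * twist x y = 0 :=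
        sum_eq_zero fun x hx => by rw [if_neg (mem_filter.1 hx).2, zero_mul]
      rw [hz, add_zero, show univ.filter (fun x => x ∈ A) = A from filter_mem_eq_inter.trans (univ_inter A), hS,
        sum_image fun v _ w _ h => by simpa only [bxor_bxor_cancel_left] using congrArg (bxor x₀) h, mul_sum]
      refine sum_congr rfl fun v hv => ?_
      beta_reduce
      rw [if_pos (mem_image.2 ⟨v, hv, rfl⟩), twist_bxor_left]
      simp only [ρ]
      have hs : signOf (d x₀) * signOf (d x₀) = 1 := by unfold signOf; split_ifs <;> norm_num
      calc signOf (d (bxor x₀ v)) * (twist x₀ y * twist v y)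
          = signOf (d (bxor x₀ v)) * (signOf (d x₀) * signOf (d x₀)) * (twist x₀ y * twist v y) := by rw [hs, mul_one]
        _ = signOf (d x₀) * twist x₀ y * (signOf (d (bxor x₀ v)) * signOf (d x₀) * twist v y) := by ring
    rcases hsumρ with h | h
    · left; rw [hDρ, h, mul_zero]
    · right; left; rw [hDρ, h, hcardV]; push_cast; ring
  have hDabs : ∀ y, |D y| = D y ^ 2 / 512 := by
    intro y
    have hc : |signOf (d x₀) * twist x₀ y| = 1 := by
      rcases Simon.twist_eq_one_or x₀ y with h | h <;> rw [h] <;> unfold signOf <;> split_ifs <;> norm_num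
    have hc2 : (signOf (d x₀) * twist x₀ y) ^ 2 = 1 := by
      rcases Simon.twist_eq_one_or x₀ y with h | h <;> rw [h] <;> unfold signOf <;> split_ifs <;> norm_num
    rcases hDval y with h | h | h
    · rw [h]; norm_num
    · rw [h, abs_mul, hc, mul_pow, hc2]; norm_num
    · rw [h, abs_neg, abs_mul, hc, neg_sq, mul_pow, hc2]; norm_num
  -- Parseval: `Σ |D| = 2¹⁴`
  have hPars := fp_parseval_pm (fun x => if x ∈ A then signOf (d x) else 0) A
    (fun x hx => by rw [if_pos hx]; unfold signOf; split_ifs <;> simp) (fun x hx => by rw [if_neg hx])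
  rw [hcard] at hPars
  have hL1 : ∑ y, |D y| = 16384 := by
    rw [sum_congr rfl fun y _ => hDabs y, ← sum_div]
    simp only [D] at hPars ⊢
    rw [hPars]; norm_num
  -- bent duality `W_d = 128·(−1)^g` and the decomposition `W_f = W_d − 2D`
  have hWd : ∀ y, W (fun x => signOf (d x)) y = 128 * signOf (g y) := by
    intro y
    have hinv := tz_inversion (fun y => signOf (g y)) y
    rw [sum_congr rfl fun x _ => by rw [hd x]] at hinv
    have e : ∑ x, (2 : ℝ) ^ 7 * signOf (d x) * twist x y = 2 ^ 7 * W (fun x => signOf (d x)) y := by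
      unfold W; rw [mul_sum]; exact sum_congr rfl fun x _ => by ring
    rw [e, show (2 : ℝ) ^ (7 + 7) = 2 ^ 7 * 128 by norm_num, mul_assoc] at hinv
    exact mul_left_cancel₀ (by norm_num) hinv
  have hWf : ∀ y, W (fun x => signOf (f x)) y = 128 * signOf (g y) - 2 * D y := by
    intro y
    have e : (fun x => signOf (f x)) = fun x => signOf (d x) + (-2) * (if x ∈ A then signOf (d x) else 0) := by
      funext x
      by_cases hx : x ∈ A
      · rw [if_pos hx]
        have h := (hmemA x).1 hx
        have : f x = !d x := by revert h; cases f x <;> cases d x <;> decide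
        rw [this]; cases d x <;> simp [signOf] <;> norm_num
      · rw [if_neg hx]
        have h : ¬ (f x ^^ d x) = true := fun h' => hx ((hmemA x).2 h')
        have : f x = d x := by revert h; cases f x <;> cases d x <;> decide
        rw [this]; ring
    rw [e, sp_W_add, fl1_W_smul, hWd]
    simp only [D]; ring
  -- the pairing on the `g`-side: `Σ_y (−1)^{g(y)} D(y) = 2¹⁶`
  have hpair := vg_two_pow_mul_forrelation g f
  rw [Summit.QuantumAdvantage.QuantumAdvantage.Theorems.SignedCubicForrelationNotPrBPP.Negative.HalfQuad.forrelation_comm, hΦ,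
    sum_congr rfl fun y _ => by rw [hWf y]] at hpair
  have hsq : ∀ y, signOf (g y) * (128 * signOf (g y) - 2 * D y) = 128 - 2 * (signOf (g y) * D y) := by
    intro y
    have : signOf (g y) * signOf (g y) = 1 := by unfold signOf; split_ifs <;> norm_num
    linear_combination 128 * this
  rw [sum_congr rfl fun y _ => hsq y, sum_sub_distrib, ← mul_sum, sum_const, card_univ, Fintype.card_fun, Fintype.card_bool,
    Fintype.card_fin, nsmul_eq_mul] at hpair
  have c1 : (2 : ℝ) ^ (3 * 7) * (15 / 16) = 1966080 := by norm_num
  have c2 : ((2 ^ (7 + 7) : ℕ) : ℝ) * 128 = 2097152 := by norm_num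
  rw [c1, c2] at hpair
  have hSD : ∑ y, signOf (g y) * D y = 65536 := by linarith
  have hle : ∑ y, signOf (g y) * D y ≤ ∑ y, |D y| := fl1_pairing_le_l1 g D
  rw [hSD, hL1] at hle
  norm_num at hle

/-- **Level 7 at the second boundary on 14 bits is exact.**  For cubic `f, g : 𝔽₂¹⁴ → 𝔽₂` with `W_g ∈ 128ℤ` and `Φ(f,g) ≥ 15/16`:
`Φ(f,g) = 1` (`fo_levelSeven` leaves only the bent value `15/16`, excluded by `fo_bent_false`).  Finite-slice statement; NOT summit
progress. [this work] -/
theorem fo_levelSeven_exact (f g : (Fin (7 + 7) → Bool) → Bool) (hf : IsDegLeFun 3 f) (hg : IsDegLeFun 3 g)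
    (w : (Fin (7 + 7) → Bool) → ℤ) (hw : ∀ x, W (fun y => signOf (g y)) x = (2 : ℝ) ^ 7 * (w x : ℝ))
    (hΦ : (15 / 16 : ℝ) ≤ forrelation f g) : forrelation f g = 1 := by
  rcases fo_levelSeven f g hf hg w hw hΦ with h | ⟨hbent, h15⟩
  · exact h
  · exact (fo_bent_false f g hf hg hbent h15).elim

end Summit.QuantumAdvantage.QuantumAdvantage.Theorems.CubicForrelation.NearExactIsExact

end
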